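import Literature.Topology.FourManifolds.SmaleHomologySpheresHCobordism
import Literature.Topology.FourManifolds.GluckTwistMeridian
import Literature.AlgebraicTopology.SingularHomology.UniverseTransport
import Literature.AlgebraicTopology.SingularHomology.FundamentalClassExistence
import Literature.AlgebraicTopology.SingularHomology.OrientationCover
import Literature.AlgebraicTopology.Homotopy.WhiteheadContractibleProofs
import Mathlib.Topology.Instances.Shrink
import HarnessLib

/-!
# Smale's theorem in Milnor's homological form: universe lift of Prop. B

Sibling of `SmaleHomologySpheres.lean` (the named facts
`Literature.Topology.FourManifolds.nonempty_homeomorph_sphere_of_homologySphere_of_five_le`,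
`Literature.Topology.FourManifolds.nonempty_diffeomorph_sphere_of_homologySphere_five_six`:
Milnor, *Lectures on the h-cobordism theorem* (1965), §9, **Prop. B**) and of the proof files
`SmaleHomologySpheresProofs.lean`, `SmaleHomologySpheresPropA.lean`,
`SmaleHomologySpheresFiveSix.lean`, `SmaleHomologySpheresHCobordism.lean`, which assemble Milnor's
printed proof of Prop. B down to the deep hubs of the tree **at universe `0`** (the tree's
cobordism vocabulary `NullCobordism`, `BallRemovalData`, `Cobordism` lives in `Type`).

Both named facts quantify over manifolds `M : Type u` in an arbitrary universe. This file closes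
the gap: **the facts at universe `0` imply the facts at every universe** (`…_of_univ_zero`), so
that the universe-`0` assemblies yield the facts as stated (`…_of_hcobordism_univ`,
`…_of_propA_univ`). The argument is the standard transport ([folklore]): a compact manifold
`M : Type u` is small (`Literature.AlgebraicTopology.SingularHomology.small_of_compactSpace_chartedSpace`),
so `Shrink.{0} M : Type` is a homeomorphic copy (`Shrink.homeomorph`); the `C^∞` structure is
transported along this homeomorphism (`Homeomorph.transportChartedSpace`,
`Homeomorph.isManifold_transportChartedSpace`, `Homeomorph.transportDiffeomorph` of
`GluckTwistMeridian.lean`), simple connectivity is a homotopy invariant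
(`ContinuousMap.HomotopyEquiv.simplyConnectedSpace`), vanishing of singular homology is
transported across universes by `Literature.AlgebraicTopology.SingularHomology.csingularHomology.isZero_of_homeomorph`
(`UniverseTransport.lean`, with the comparison `csingularHomology.compIso`), and `Hₙ ≅ ℤ` for the
copy is Hatcher's Thm. 3.26(a) for the closed simply connected (hence `ℤ`-oriented, Prop. 3.25)
manifold `Shrink.{0} M` (`nonempty_singularHomology_top_iso_holds`,
`isOrientableOver_of_simplyConnectedSpace`, both proved in the tree). The conclusion
`Shrink.{0} M ≃ₜ Sⁿ` (resp. `≃ₘ`) is composed with `M ≃ₜ Shrink.{0} M` (resp. the transport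
diffeomorphism).

## Main statements

* `SmaleHomologySpheres.isZero_singularHomology_of_homeomorph`: `Hₖ(X; ℤ) = 0 ⟹ Hₖ(Y; ℤ) = 0`
  for `X ≃ₜ Y` across universes (Mathlib's model of singular homology);
* `SmaleHomologySpheres.nonempty_singularHomology_top_iso_of_simplyConnectedSpace`:
  `Hₙ(X; ℤ) ≅ ℤ` for a closed simply connected topological `n`-manifold `X : Type`;
* `nonempty_homeomorph_sphere_of_homologySphere_of_five_le_of_univ_zero`: Prop. B (homeomorphism
  clause) at universe `0` implies it at universe `u`;
* `nonempty_diffeomorph_sphere_of_homologySphere_five_six_of_univ_zero`: the same for the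
  diffeomorphism clause (`n = 5, 6`);
* `nonempty_homeomorph_sphere_of_homologySphere_of_five_le_of_hcobordism_univ`: **Prop. B at every
  universe from the four hubs** (the h-cobordism theorem, Kervaire–Milnor's Lemma 2.3, the
  Whitehead–Hurewicz criterion, the Kervaire–Milnor/Wall theorem), i.e. the universe-polymorphic
  form of `nonempty_homeomorph_sphere_of_homologySphere_of_five_le_of_hcobordism`;
* `nonempty_homeomorph_sphere_of_homologySphere_of_five_le_of_propA_univ`,
  `nonempty_diffeomorph_sphere_of_homologySphere_five_six_of_propA_univ`: the same from Prop. A and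
  Kervaire–Milnor/Wall;
* `nonempty_homeomorph_sphere_of_homologySphere_of_five_le_of_three_hubs`: **Prop. B at every
  universe from the three hubs that remain named facts** — the Whitehead–Hurewicz criterion is
  discharged in the tree (`Manifold.contractibleSpace_of_simplyConnected_of_acyclic_holds`,
  `WhiteheadContractibleProofs.lean`) and is fed in here, leaving the h-cobordism theorem,
  Kervaire–Milnor's Lemma 2.3 and the Kervaire–Milnor/Wall theorem.

Everything here is proved; no new named fact is introduced.

## References

* J. Milnor, *Lectures on the h-cobordism theorem*, notes by L. Siebenmann and J. Sondow,
  Princeton University Press (1965), §9, Prop. A, Prop. B and their proofs, pp. 107–111 (held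
  copy PDF pp. 57–59). [MilnorHCobordism1965]
* A. Hatcher, *Algebraic Topology*, CUP (2002), Prop. 3.25, Thm. 3.26(a). [HatcherAT2002]
-/

noncomputable section

open scoped Manifold ContDiff Topology ContinuousMap
open CategoryTheory Limits Set Function

universe u w

namespace Literature.Topology.FourManifolds

namespace SmaleHomologySpheres

open Literature.AlgebraicTopology.SingularHomology

/-! ### Homological hypotheses across universes -/

/-- **Vanishing of singular homology is invariant under homeomorphisms across universes**
(Mathlib's model): for `e : X ≃ₜ Y` with `X : Type u`, `Y : Type w`,
`Hₖ(X; ℤ) = 0 ⟹ Hₖ(Y; ℤ) = 0` — the concrete statement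
`csingularHomology.isZero_of_homeomorph` (`UniverseTransport.lean`) conjugated by the comparison
isomorphisms `csingularHomology.compIso` (Hatcher 2002, §2.1). [folklore] -/
theorem isZero_singularHomology_of_homeomorph {X : Type u} {Y : Type w} [TopologicalSpace X]
    [TopologicalSpace Y] (e : X ≃ₜ Y) (k : ℕ) (h : IsZero (singularHomology ℤ ℤ X k)) :
    IsZero (singularHomology ℤ ℤ Y k) :=
  (csingularHomology.isZero_of_homeomorph ℤ ℤ e
    (h.of_iso (csingularHomology.compIso ℤ ℤ X k))).of_iso (csingularHomology.compIso ℤ ℤ Y k).symm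

/-- **`Hₙ(X; ℤ) ≅ ℤ` for a closed simply connected topological `n`-manifold `X : Type`**: `X` is
`ℤ`-orientable (Hatcher 2002, Prop. 3.25; tree: `isOrientableOver_of_simplyConnectedSpace`) and
connected, so `Hₙ(X; ℤ) ≅ ℤ` (Hatcher Thm. 3.26(a); tree:
`nonempty_singularHomology_top_iso_holds`). [cite: HatcherAT2002, Prop. 3.25, Thm. 3.26(a)] -/
theorem nonempty_singularHomology_top_iso_of_simplyConnectedSpace {n : ℕ} (X : Type)
    [TopologicalSpace X] [T2Space X] [CompactSpace X] [ChartedSpace (EuclideanSpace ℝ (Fin n)) X]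
    [SimplyConnectedSpace X] :
    Nonempty (singularHomology ℤ ℤ X n ≅ ModuleCat.of ℤ (ULift.{0} ℤ)) := by
  obtain ⟨μ⟩ := isOrientableOver_of_simplyConnectedSpace ℤ X (n := n)
  haveI : ConnectedSpace X := inferInstance
  exact nonempty_singularHomology_top_iso_holds n μ

end SmaleHomologySpheres

/-! ### Universe lift of the two clauses of Prop. B -/

/-- **Universe lift, homeomorphism clause.** Prop. B (homeomorphism clause) at universe `0`
implies it at every universe `u`: a closed manifold `M : Type u` is small
(`small_of_compactSpace_chartedSpace`), so `Shrink.{0} M : Type` is a homeomorphic copy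
(`Shrink.homeomorph`) carrying the transported `C^∞` structure
(`Homeomorph.transportChartedSpace`, `Homeomorph.isManifold_transportChartedSpace`); it is again
compact, Hausdorff, second countable, simply connected
(`ContinuousMap.HomotopyEquiv.simplyConnectedSpace`), with `Hₖ = 0` for `0 < k ≠ n`
(`SmaleHomologySpheres.isZero_singularHomology_of_homeomorph`) and `Hₙ ≅ ℤ`
(`SmaleHomologySpheres.nonempty_singularHomology_top_iso_of_simplyConnectedSpace`; the hypothesis
`Hₙ(M; ℤ) ≅ ℤ` is automatic for closed simply connected manifolds and is not transported), hence
homeomorphic to `Sⁿ`, and so is `M`. [folklore] -/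
theorem nonempty_homeomorph_sphere_of_homologySphere_of_five_le_of_univ_zero
    (h0 : nonempty_homeomorph_sphere_of_homologySphere_of_five_le.{0}) :
    nonempty_homeomorph_sphere_of_homologySphere_of_five_le.{u} := by
  intro n hn M _ _ _ _ _ _ _ hH _hT
  haveI : Small.{0} M :=
    Literature.AlgebraicTopology.SingularHomology.small_of_compactSpace_chartedSpace (EuclideanSpace ℝ (Fin n))
  let φ : M ≃ₜ Shrink.{0} M := Shrink.homeomorph M
  letI : ChartedSpace (EuclideanSpace ℝ (Fin n)) (Shrink.{0} M) := Homeomorph.transportChartedSpace φ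
  haveI : IsManifold (𝓡 n) ∞ (Shrink.{0} M) :=
    Homeomorph.isManifold_transportChartedSpace (I₀ := 𝓡 n) (n := ∞) φ
  haveI : T2Space (Shrink.{0} M) := φ.t2Space
  haveI : SecondCountableTopology (Shrink.{0} M) := φ.symm.secondCountableTopology
  haveI : CompactSpace (Shrink.{0} M) := φ.compactSpace
  haveI : SimplyConnectedSpace (Shrink.{0} M) := φ.symm.toHomotopyEquiv.simplyConnectedSpace
  have hH' : ∀ k : ℕ, 0 < k → k ≠ n →
      IsZero (Literature.AlgebraicTopology.SingularHomology.singularHomology ℤ ℤ (Shrink.{0} M) k) :=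
    fun k hk hkn => SmaleHomologySpheres.isZero_singularHomology_of_homeomorph φ k (hH k hk hkn)
  obtain ⟨e⟩ := h0 n hn (Shrink.{0} M) hH'
    (SmaleHomologySpheres.nonempty_singularHomology_top_iso_of_simplyConnectedSpace (Shrink.{0} M))
  exact ⟨φ.trans e⟩

/-- **Universe lift, diffeomorphism clause (`n = 5, 6`).** The diffeomorphism clause of Prop. B at
universe `0` implies it at every universe `u`: as in
`nonempty_homeomorph_sphere_of_homologySphere_of_five_le_of_univ_zero`, with the transporting
homeomorphism `M ≃ₜ Shrink.{0} M` upgraded to a diffeomorphism for the transported structure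
(`Homeomorph.transportDiffeomorph`) and composed with `Shrink.{0} M ≃ₘ Sⁿ`. [folklore] -/
theorem nonempty_diffeomorph_sphere_of_homologySphere_five_six_of_univ_zero
    (h0 : nonempty_diffeomorph_sphere_of_homologySphere_five_six.{0}) :
    nonempty_diffeomorph_sphere_of_homologySphere_five_six.{u} := by
  intro n hn M _ _ _ _ _ _ _ hH _hT
  haveI : Small.{0} M :=
    Literature.AlgebraicTopology.SingularHomology.small_of_compactSpace_chartedSpace (EuclideanSpace ℝ (Fin n))
  let φ : M ≃ₜ Shrink.{0} M := Shrink.homeomorph M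
  letI : ChartedSpace (EuclideanSpace ℝ (Fin n)) (Shrink.{0} M) := Homeomorph.transportChartedSpace φ
  haveI : IsManifold (𝓡 n) ∞ (Shrink.{0} M) :=
    Homeomorph.isManifold_transportChartedSpace (I₀ := 𝓡 n) (n := ∞) φ
  haveI : T2Space (Shrink.{0} M) := φ.t2Space
  haveI : SecondCountableTopology (Shrink.{0} M) := φ.symm.secondCountableTopology
  haveI : CompactSpace (Shrink.{0} M) := φ.compactSpace
  haveI : SimplyConnectedSpace (Shrink.{0} M) := φ.symm.toHomotopyEquiv.simplyConnectedSpace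
  have hH' : ∀ k : ℕ, 0 < k → k ≠ n →
      IsZero (Literature.AlgebraicTopology.SingularHomology.singularHomology ℤ ℤ (Shrink.{0} M) k) :=
    fun k hk hkn => SmaleHomologySpheres.isZero_singularHomology_of_homeomorph φ k (hH k hk hkn)
  obtain ⟨e⟩ := h0 n hn (Shrink.{0} M) hH'
    (SmaleHomologySpheres.nonempty_singularHomology_top_iso_of_simplyConnectedSpace (Shrink.{0} M))
  exact ⟨(Homeomorph.transportDiffeomorph (I₀ := 𝓡 n) (n := ∞) φ).trans e⟩

/-! ### Assembly at every universe -/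

/-- **Milnor's proof of Prop. B, assembled down to the h-cobordism theorem, at every universe.**
The named fact `nonempty_homeomorph_sphere_of_homologySphere_of_five_le.{u}` (Milnor 1965, §9,
Prop. B: a closed simply connected smooth `n`-manifold, `n ≥ 5`, with the integral homology of
`Sⁿ` is homeomorphic to `Sⁿ`) follows from the four hubs of the tree at universe `0` — the
h-cobordism theorem (`isTrivial_of_isHCobordism_of_five_le`, Milnor Thm. 9.1), the homotopy
theory of Kervaire–Milnor's Lemma 2.3
(`NullCobordism.isHomotopyEquiv_compl_ball_of_contractibleSpace`), the Whitehead–Hurewicz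
criterion (`contractibleSpace_of_simplyConnected_of_acyclic`) and the Kervaire–Milnor/Wall
theorem (`Milnor1965_boundsContractible_of_homologySphere`) — by the universe-`0` assembly
`nonempty_homeomorph_sphere_of_homologySphere_of_five_le_of_hcobordism`
(`SmaleHomologySpheresHCobordism.lean`) and the universe lift
`nonempty_homeomorph_sphere_of_homologySphere_of_five_le_of_univ_zero`. When the four hubs are
discharged, `nonempty_homeomorph_sphere_of_homologySphere_of_five_le_holds` is this theorem applied
to their `_holds`. [cite: MilnorHCobordism1965, §9, Thm. 9.1, Prop. A, Prop. B and their proofs (pp. 107–111; PDF pp. 57–59)] -/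
theorem nonempty_homeomorph_sphere_of_homologySphere_of_five_le_of_hcobordism_univ
    (h91 : isTrivial_of_isHCobordism_of_five_le.{0})
    (h23 : NullCobordism.isHomotopyEquiv_compl_ball_of_contractibleSpace)
    (hWh : Literature.AlgebraicTopology.Homotopy.Manifold.contractibleSpace_of_simplyConnected_of_acyclic.{0})
    (hKM : Milnor1965_boundsContractible_of_homologySphere.{0}) :
    nonempty_homeomorph_sphere_of_homologySphere_of_five_le.{u} :=
  nonempty_homeomorph_sphere_of_homologySphere_of_five_le_of_univ_zero
    (nonempty_homeomorph_sphere_of_homologySphere_of_five_le_of_hcobordism h91 h23 hWh hKM)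

/-- **Prop. B at every universe from Prop. A and Kervaire–Milnor/Wall** (Milnor's two deep inputs
of §9 as printed): the universe-`0` assembly
`nonempty_homeomorph_sphere_of_homologySphere_of_five_le_of_propA_of_boundsContractible`
(`SmaleHomologySpheresFiveSix.lean`) lifted by
`nonempty_homeomorph_sphere_of_homologySphere_of_five_le_of_univ_zero`. [cite: MilnorHCobordism1965, §9, Prop. A, Prop. B and its proof (pp. 108–111; PDF pp. 57–59)] -/
theorem nonempty_homeomorph_sphere_of_homologySphere_of_five_le_of_propA_univ
    (hA : Milnor1965_propA.{0}) (hKM : Milnor1965_boundsContractible_of_homologySphere.{0}) :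
    nonempty_homeomorph_sphere_of_homologySphere_of_five_le.{u} :=
  nonempty_homeomorph_sphere_of_homologySphere_of_five_le_of_univ_zero
    (nonempty_homeomorph_sphere_of_homologySphere_of_five_le_of_propA_of_boundsContractible hA hKM)

/-- **The diffeomorphism clause of Prop. B (`n = 5, 6`) at every universe from Prop. A and
Kervaire–Milnor/Wall**: the universe-`0` assembly
`nonempty_diffeomorph_sphere_of_homologySphere_five_six_of_propA` (`SmaleHomologySpheresFiveSix.lean`)
lifted by `nonempty_diffeomorph_sphere_of_homologySphere_five_six_of_univ_zero`. [cite: MilnorHCobordism1965, §9, Prop. B and its proof (pp. 109–111; PDF pp. 58–59)] -/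
theorem nonempty_diffeomorph_sphere_of_homologySphere_five_six_of_propA_univ
    (hA : Milnor1965_propA.{0}) (hKM : Milnor1965_boundsContractible_of_homologySphere.{0}) :
    nonempty_diffeomorph_sphere_of_homologySphere_five_six.{u} :=
  nonempty_diffeomorph_sphere_of_homologySphere_five_six_of_univ_zero
    (nonempty_diffeomorph_sphere_of_homologySphere_five_six_of_propA hA hKM)

/-! ### Assembly over the three hubs that remain named facts -/

/-- **Milnor's Prop. B at every universe from the three remaining hubs.** The named fact
`nonempty_homeomorph_sphere_of_homologySphere_of_five_le.{u}` (Milnor 1965, §9, Prop. B) follows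
from the h-cobordism theorem (`isTrivial_of_isHCobordism_of_five_le`, Milnor Thm. 9.1), the
homotopy theory of Kervaire–Milnor's Lemma 2.3
(`NullCobordism.isHomotopyEquiv_compl_ball_of_contractibleSpace`) and the Kervaire–Milnor/Wall
theorem (`Milnor1965_boundsContractible_of_homologySphere`), all at universe `0`: the fourth input
of `nonempty_homeomorph_sphere_of_homologySphere_of_five_le_of_hcobordism_univ`, the
Whitehead–Hurewicz criterion for manifolds (Bredon 1993, VII Cor. 10.11), is a theorem of the tree
(`Literature.AlgebraicTopology.Homotopy.Manifold.contractibleSpace_of_simplyConnected_of_acyclic_holds`).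
When the three hubs are discharged, `nonempty_homeomorph_sphere_of_homologySphere_of_five_le_holds`
is this theorem applied to their `_holds`. [cite: MilnorHCobordism1965, §9, Thm. 9.1, Prop. A, Prop. B and their proofs (pp. 107–111; PDF pp. 57–59)] -/
theorem nonempty_homeomorph_sphere_of_homologySphere_of_five_le_of_three_hubs
    (h91 : isTrivial_of_isHCobordism_of_five_le.{0})
    (h23 : NullCobordism.isHomotopyEquiv_compl_ball_of_contractibleSpace)
    (hKM : Milnor1965_boundsContractible_of_homologySphere.{0}) :
    nonempty_homeomorph_sphere_of_homologySphere_of_five_le.{u} :=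
  nonempty_homeomorph_sphere_of_homologySphere_of_five_le_of_hcobordism_univ h91 h23
    Literature.AlgebraicTopology.Homotopy.Manifold.contractibleSpace_of_simplyConnected_of_acyclic_holds
    hKM

end Literature.Topology.FourManifolds

end
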